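import Summits.BirchSwinnertonDyer.BirchSwinnertonDyer.Theorems.PrintCFramBottomClassIndexLawFiveLeHerbrandOddClassGroupHom
import Summits.BirchSwinnertonDyer.BirchSwinnertonDyer.Theorems.PrintCFramBottomClassIndexLawFiveLeHerbrandRationalTransport
import HarnessLib

/-!
# Route `PrintCFram`, crux C2 `BottomClassIndexLawFiveLe` (stmt-BirchSwinnertonDyer-20372), line
# `eisenstein-resource-bdp-line` (LEAD g9, Road C «conjugation swap»): STUB O — THE ODD VANISHING `ODD(r, res(Γ_L))` IN
# `Γ_ℚ`-CURRENCY, FROM MAZUR–WILES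
# (cell `bsd-print-cfram`, seat `bsd-line-cfram-p1-w6` g0; helper `--supports` 20372; 0 facts, 0 defs)

HONEST FRAMING. Nothing about BSD is proved here; no summit statement is proved by this seat. LEAD g9's Road C (STATUS 18:01Z)
cuts Stub H′ into D (dictionary), O (odd vanishing), E (even vanishing) through the abstract swap `HerbrandSwap.swap_vanishing`
(p655023). In LEAD g9's printed currency (`Γ_ℚ = absoluteGaloisGroup ℚ`, `N ≤ Γ_ℚ`, `r : Γ_ℚ →* 𝔽_pˣ`):

  `ODD(r, N)` := every `G : Γ_ℚ → 𝔽_p`, continuous and additive on `N`, with `G(g n g⁻¹) = r(g)·G(n)` for all `g ∈ Γ_ℚ`, `n ∈ N`,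
  and `G(n) = 0` for `n ∈ N ∩ I_𝔓`, `𝔓` any prime of `\bar ℤ` (`𝔓 ∈ ℓ.primesAbove`, all `ℓ`), vanishes on `N`;

and STUB O = «Mazur–Wiles ⟹ `ODD(r, range res_{ℚ,L})`» for `L/ℚ` abelian with `p ∤ [L:ℚ]` and `r` the odd line character
(trivial on `res(Γ_L)`). This file proves exactly that, with the Dirichlet data of `r` as explicit hypotheses (supplied by D-dir, w3 g4
p655149: the primitive odd avatar `χ` of the Teichmüller lift `φ` of `r`, `‖B_{1,χ⁻¹}‖_p = 1`):

* TRANSPORT `Γ_L ↝ N = res(Γ_L)` is D-gal's (w4 g5, p655726 `HerbrandSelmerToHom.oddVanishQ_of_forall_character_field`: pull `G`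
  back along `res = absGaloisRestrict ℚ L` to a character `κ : Γ_L →* 𝔽_p` with open kernel, killing every `I_𝔔 ≤ Γ_L`, with the
  eigen-law `κ(θ_γ σ) = κ(σ)^{r(γ)}`; so `ODD_L(r) ⟹ ODD(r, N)`).
* `ODD_L(r)` is this seat's `HerbrandOddClassGroup.absGaloisHom_eq_one_final` (p655378: Hilbert class field p654556 + Frobenius
  equivariance p654872 + Mazur–Wiles F1ᵈ p653451).
* `oddVanish_range_final` — STUB O = the composition, hypotheses in final `Γ_ℚ`-currency.

THEOREMS ONLY; no definition, no named fact, no `sorry`; imports no `Theses` module. Mazur–Wiles Thm. 2 is a HYPOTHESIS (`hMW`, the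
w8 typing `MazurWiles1984.thm2_oddChiPart_classGroup_card_eq_pow_val_bernoulli`).
References: [MazurWiles1984] Thm. 2 (p. 216) via [Solomon1990] p. 468; [NeukirchANT1999] Ch. I §9 (9.4), Ch. IV §1, Ch. VI §7 (7.1);
Gross, LNM 776, Lemma 22.3.4 (the pattern of Road C).
-/

set_option autoImplicit false
set_option linter.dupNamespace false

noncomputable section

open NumberField Field IsDedekindDomain
open Literature.NumberTheory.GaloisRepresentations Literature.NumberTheory.NumberFields
open Literature.NumberTheory.EllipticCurves Literature.NumberTheory.LFunctions
open Summit.BirchSwinnertonDyer.BirchSwinnertonDyer.Theorems.PrintCFram.HerbrandSelmerToHom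

namespace Summit.BirchSwinnertonDyer.BirchSwinnertonDyer.Theorems.PrintCFram.HerbrandOddClassGroup

variable {p : ℕ} [Fact p.Prime] {L : Type} [Field L] [NumberField L]

/-! ## Stub O: `ODD(r, range res_{ℚ,L})` from Mazur–Wiles -/

section Final

variable [IsAbelianGalois ℚ L]

/-- **STUB O (Road C) — THE ODD VANISHING FROM MAZUR–WILES.** `p` odd; `L/ℚ` abelian with `p ∤ [L:ℚ]`; `χ` a primitive odd
`ℚ_p`-valued Dirichlet character of conductor `f` with `‖B_{1,χ⁻¹}‖_p = 1`; `φ : Γ_ℚ → ℤ_pˣ` trivial on `res(Γ_L)` with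
`φ(τ) = χ(χ_f(τ))` and reduction `r = φ mod p : Γ_ℚ → 𝔽_pˣ`; ASSUME Mazur–Wiles Thm. 2 (`hMW`). Then `ODD(r, range res_{ℚ,L})`: every
`G : Γ_ℚ → 𝔽_p`, continuous and additive on `N = res(Γ_L)`, with `G(g n g⁻¹) = r(g) G(n)` (`g ∈ Γ_ℚ`, `n ∈ N`) and `G = 0` on `N ∩ I_𝔓`
for every prime `𝔓` of `\bar ℤ`, vanishes on `N`.
[cite: MazurWiles1984, Thm. 2 (p. 216) — via Solomon1990, §I p. 468; NeukirchANT1999, Ch. VI §7 Thm. (7.1) and Ch. I §9 (9.4)] -/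
theorem oddVanish_range_final
    (hMW : MazurWiles1984.thm2_oddChiPart_classGroup_card_eq_pow_val_bernoulli) (hp2 : p ≠ 2)
    (hpL : ¬ p ∣ Module.finrank ℚ L)
    {f : ℕ} [NeZero f] {χ : DirichletCharacter ℚ_[p] f} (hprim : χ.IsPrimitive) (hodd : χ.Odd)
    (φ : absoluteGaloisGroup ℚ →* ℤ_[p]ˣ)
    (hφL : ∀ σ : absoluteGaloisGroup L, φ (absGaloisRestrict ℚ L σ) = 1)
    (hφχ : ∀ τ : absoluteGaloisGroup ℚ,
      (((φ τ : ℤ_[p]ˣ) : ℤ_[p]) : ℚ_[p]) = χ ((modNCyclotomicCharacter ℚ f τ : (ZMod f)ˣ) : ZMod f))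
    (hB : ‖KrizLi2019.bernoulliOnePrim χ⁻¹‖ = 1)
    (r : absoluteGaloisGroup ℚ →* (ZMod p)ˣ)
    (hr : ∀ τ : absoluteGaloisGroup ℚ, PadicInt.toZMod ((φ τ : ℤ_[p]ˣ) : ℤ_[p]) = ((r τ : (ZMod p)ˣ) : ZMod p))
    (G : absoluteGaloisGroup ℚ → ZMod p)
    (hGc : Continuous fun n : (absGaloisRestrict ℚ L).range => G n)
    (hadd : ∀ a ∈ (absGaloisRestrict ℚ L).range, ∀ b ∈ (absGaloisRestrict ℚ L).range, G (a * b) = G a + G b)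
    (hconj : ∀ g, ∀ n ∈ (absGaloisRestrict ℚ L).range, G (g * n * g⁻¹) = (r g : ZMod p) * G n)
    (hI : ∀ (ℓ : HeightOneSpectrum (𝓞 ℚ)) (𝔓 : Ideal (absIntegers (𝓞 ℚ) ℚ)), 𝔓 ∈ ℓ.primesAbove →
      ∀ n ∈ (absGaloisRestrict ℚ L).range, n ∈ 𝔓.inertia (absoluteGaloisGroup ℚ) → G n = 0) :
    ∀ n ∈ (absGaloisRestrict ℚ L).range, G n = 0 :=
  haveI : NeZero p := ⟨(Fact.out : p.Prime).ne_zero⟩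
  oddVanishQ_of_forall_character_field r
    (fun κ hκ heq hunr => absGaloisHom_eq_one_final hMW hp2 hpL hprim hodd φ hφL hφχ hB r hr κ hκ hunr heq)
    G hGc hadd hconj hI

/-- **STUB O, level-`m` / Teichmüller form (the D-dir output currency of w3 g4's `lineCharacters_bernoulliUnits_of_heegner`).**
`p` odd; `L/ℚ` abelian with `p ∤ [L:ℚ]`; `r : Γ_ℚ → 𝔽_pˣ` trivial on `res(Γ_L)`; `ψ` a `ℚ_p`-valued Dirichlet character of ANY
level `m` with `ψ(χ_m τ) = ω(r τ)` for all `τ ∈ Γ_ℚ` (`ω` = `Kato2004.teichmullerChar`, i.e. `ψ = ω ∘ b` for `r = b ∘ χ_m`), `ψ` odd,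
`‖bernoulliOnePrim ψ⁻¹‖_p = 1`; ASSUME Mazur–Wiles. Then `ODD(r, range res_{ℚ,L})`. (Reduction to `oddVanish_range_final`: `φ = ω ∘ r`,
`χ = ψ.primitiveCharacter`, `χ_m ↦ χ_f` by `Mazur1978.unitsMap_modNCyclotomicCharacter`, `bernoulliOnePrim` is level-invariant.)
[cite: MazurWiles1984, Thm. 2 (p. 216) — via Solomon1990, §I p. 468; Washington1997, §5.1 (Teichmüller character)] -/
theorem oddVanish_range_final_of_teichmuller
    (hMW : MazurWiles1984.thm2_oddChiPart_classGroup_card_eq_pow_val_bernoulli) (hp2 : p ≠ 2)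
    (hpL : ¬ p ∣ Module.finrank ℚ L)
    (r : absoluteGaloisGroup ℚ →* (ZMod p)ˣ) (hrL : ∀ σ : absoluteGaloisGroup L, r (absGaloisRestrict ℚ L σ) = 1)
    {m : ℕ} [NeZero m] (ψ : DirichletCharacter ℚ_[p] m)
    (hψ : ∀ τ : absoluteGaloisGroup ℚ, ψ ((modNCyclotomicCharacter ℚ m τ : (ZMod m)ˣ) : ZMod m) =
      (((Kato2004.teichmullerChar p (r τ) : ℤ_[p]ˣ) : ℤ_[p]) : ℚ_[p]))
    (hodd : ψ.Odd) (hB : ‖KrizLi2019.bernoulliOnePrim ψ⁻¹‖ = 1)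
    (G : absoluteGaloisGroup ℚ → ZMod p)
    (hGc : Continuous fun n : (absGaloisRestrict ℚ L).range => G n)
    (hadd : ∀ a ∈ (absGaloisRestrict ℚ L).range, ∀ b ∈ (absGaloisRestrict ℚ L).range, G (a * b) = G a + G b)
    (hconj : ∀ g, ∀ n ∈ (absGaloisRestrict ℚ L).range, G (g * n * g⁻¹) = (r g : ZMod p) * G n)
    (hI : ∀ (ℓ : HeightOneSpectrum (𝓞 ℚ)) (𝔓 : Ideal (absIntegers (𝓞 ℚ) ℚ)), 𝔓 ∈ ℓ.primesAbove →
      ∀ n ∈ (absGaloisRestrict ℚ L).range, n ∈ 𝔓.inertia (absoluteGaloisGroup ℚ) → G n = 0) :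
    ∀ n ∈ (absGaloisRestrict ℚ L).range, G n = 0 := by
  haveI : NeZero ψ.conductor := ⟨ψ.conductor_ne_zero⟩
  -- the Teichmüller lift `φ = ω ∘ r`
  let φ : absoluteGaloisGroup ℚ →* ℤ_[p]ˣ := (Kato2004.teichmullerChar p).comp r
  have hφ : ∀ τ, φ τ = Kato2004.teichmullerChar p (r τ) := fun τ => rfl
  have hφL : ∀ σ : absoluteGaloisGroup L, φ (absGaloisRestrict ℚ L σ) = 1 := fun σ => by
    rw [hφ, hrL, map_one]
  have hr : ∀ τ : absoluteGaloisGroup ℚ, PadicInt.toZMod ((φ τ : ℤ_[p]ˣ) : ℤ_[p]) = ((r τ : (ZMod p)ˣ) : ZMod p) :=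
    fun τ => by rw [hφ, Kato2004.toZMod_teichmullerChar]
  -- the primitive character `χ` of `ψ`
  have hdvd := ψ.conductor_dvd_level
  have hψχ : ∀ u : (ZMod m)ˣ, ψ (u : ZMod m) = ψ.primitiveCharacter ((ZMod.unitsMap hdvd u : (ZMod ψ.conductor)ˣ) :
      ZMod ψ.conductor) := fun u => by
    conv_lhs => rw [← DirichletCharacter.changeLevel_primitiveCharacter ψ]
    rw [DirichletCharacter.changeLevel_eq_cast_of_dvd _ hdvd, ZMod.unitsMap_def, Units.coe_map, MonoidHom.coe_coe,
      ZMod.castHom_apply]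
  have hprim : ψ.primitiveCharacter.IsPrimitive := DirichletCharacter.primitiveCharacter_isPrimitive ψ
  have hodd' : ψ.primitiveCharacter.Odd := by
    have h := hψχ (-1)
    rw [ZMod.unitsMap_def, Units.map_neg_one, Units.val_neg, Units.val_one, Units.val_neg, Units.val_one] at h
    rw [DirichletCharacter.Odd, ← h]
    exact hodd
  have hφχ : ∀ τ : absoluteGaloisGroup ℚ, (((φ τ : ℤ_[p]ˣ) : ℤ_[p]) : ℚ_[p]) =
      ψ.primitiveCharacter ((modNCyclotomicCharacter ℚ ψ.conductor τ : (ZMod ψ.conductor)ˣ) : ZMod ψ.conductor) :=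
    fun τ => by rw [hφ, ← hψ τ, hψχ, Mazur1978.unitsMap_modNCyclotomicCharacter hdvd]
  have hB' : ‖KrizLi2019.bernoulliOnePrim ψ.primitiveCharacter⁻¹‖ = 1 := by
    rw [← RegularLocusBernoulliPair.bernoulliOnePrim_changeLevel hdvd, map_inv,
      DirichletCharacter.changeLevel_primitiveCharacter]
    exact hB
  exact oddVanish_range_final hMW hp2 hpL hprim hodd' φ hφL hφχ hB' r hr G hGc hadd hconj hI

/-! ### Frobenius-avatar currency (`IsDirichletAvatar`, the hypothesis shape of the Mazur–Wiles typing itself) -/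

open Module Module.End Literature.RepresentationTheory.FiniteGroups

/-- **`Γ_L`-level odd vanishing, Frobenius-avatar form.** As `absGaloisHom_eq_one_final`, but the character is given on `Gal(L/ℚ)`
(`ψ : Gal(L/ℚ) → ℤ_pˣ`) with a FROBENIUS avatar `IsDirichletAvatar L ψ χ m` (`ψ(Frob_ℓ) = χ(ℓ)` for `ℓ ∤ m`; `χ` primitive odd,
`‖B_{1,χ⁻¹}‖_p = 1`) instead of a pointwise one, and `r = ψ mod p` read on `Γ_ℚ` (`r τ = ψ(τ̄) mod p`). Then every `κ : Γ_L →* 𝔽_p` with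
open kernel, killing all inertia, with `κ(θ_γ σ) = κ(σ)^{r(γ)}`, is trivial. (Use: the `ε_K`-twisted odd line character, whose avatar is
naturally Frobenius-style via `IsKroneckerCharacterOf`.)
[cite: MazurWiles1984, Thm. 2 (p. 216) — via Solomon1990, §I p. 468; NeukirchANT1999, Ch. VI §7 Thm. (7.1)] -/
theorem absGaloisHom_eq_one_of_isDirichletAvatar
    (hMW : MazurWiles1984.thm2_oddChiPart_classGroup_card_eq_pow_val_bernoulli) (hp2 : p ≠ 2)
    (hpL : ¬ p ∣ Module.finrank ℚ L) (ψ : (L ≃ₐ[ℚ] L) →* ℤ_[p]ˣ)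
    {f : ℕ} [NeZero f] (χ : DirichletCharacter ℚ_[p] f) (m : ℕ) (hprim : χ.IsPrimitive)
    (havatar : IsDirichletAvatar L ψ χ m) (hodd : χ.Odd) (hB : ‖KrizLi2019.bernoulliOnePrim χ⁻¹‖ = 1)
    (r : absoluteGaloisGroup ℚ →* (ZMod p)ˣ)
    (hr : ∀ τ : absoluteGaloisGroup ℚ,
      PadicInt.toZMod ((ψ (absGaloisQuot ℚ L τ) : ℤ_[p]ˣ) : ℤ_[p]) = ((r τ : (ZMod p)ˣ) : ZMod p))
    (κ : absoluteGaloisGroup L →* Multiplicative (ZMod p)) (hκ : IsOpen (κ.ker : Set (absoluteGaloisGroup L)))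
    (hunr : ∀ (v : HeightOneSpectrum (𝓞 L)) (𝔓 : Ideal (absIntegers (𝓞 L) L)), 𝔓 ∈ v.primesAbove →
      ∀ g ∈ 𝔓.inertia (absoluteGaloisGroup L), κ g = 1)
    (heq : ∀ (γ : absoluteGaloisGroup ℚ) (σ : absoluteGaloisGroup L),
      κ (absGaloisOuterConj ℚ L γ σ) = (κ σ) ^ ((r γ : (ZMod p)ˣ) : ZMod p).val) :
    κ = 1 := by
  have hgen : ‖(generalizedBernoulli 1 χ⁻¹ : ℚ_[p])‖ = 1 := by
    rw [← bernoulliOnePrim_inv_eq_generalizedBernoulli hprim]; exact hB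
  have hω := BernoulliUnits.not_isTeichmuller_of_norm_generalizedBernoulli_inv_le_one hp2 χ hgen.le
  let θ : (L ≃ₐ[ℚ] L) →* (ZMod p)ˣ := (Units.map (PadicInt.toZMod (p := p)).toMonoidHom).comp ψ
  have hθ : ∀ σ : L ≃ₐ[ℚ] L, PadicInt.toZMod ((ψ σ : ℤ_[p]ˣ) : ℤ_[p]) = ((θ σ : (ZMod p)ˣ) : ZMod p) :=
    fun σ => rfl
  haveI : Invertible (Fintype.card (L ≃ₐ[ℚ] L) : ZMod p) := (isUnit_card_gal_zmod hpL).invertible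
  obtain ⟨g, hg⟩ := exists_factor_classGroup_of_unramified_of_odd L (odd_natCard_multiplicative_zmod hp2) κ hκ hunr
  have hg1 : g = 1 := by
    refine classGroupHom_eq_one_of_forall_linearMap_eq_zero θ (fun F hF =>
      HerbrandEigenspace.eq_zero_of_equivariant_of_iInf_eigenspace_eq_bot _ θ
        (iInf_eigenspace_classGroup_modP_eq_bot_of_isDirichletAvatar hMW hp2 hpL ψ χ m hprim havatar hodd hω hgen θ hθ)
        F hF) g fun σ c => ?_
    obtain ⟨τ, rfl⟩ := absGaloisQuot_surjective ℚ L σ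
    rw [← hθ, hr τ]
    exact classGroupHom_mulEquiv_eq_pow_val hg r heq τ c
  ext τ
  rw [hg τ, hg1, MonoidHom.one_apply, MonoidHom.one_apply]

/-- **STUB O, Frobenius-avatar form.** `p` odd; `L/ℚ` abelian, `p ∤ [L:ℚ]`; `ψ : Gal(L/ℚ) → ℤ_pˣ` with Frobenius avatar the
primitive odd `χ` (`IsDirichletAvatar L ψ χ m`) and `‖B_{1,χ⁻¹}‖_p = 1`; `r = ψ mod p` on `Γ_ℚ`; ASSUME Mazur–Wiles. Then
`ODD(r, range res_{ℚ,L})`. [cite: MazurWiles1984, Thm. 2 (p. 216) — via Solomon1990, §I p. 468; NeukirchANT1999, Ch. I §9 (9.4)] -/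
theorem oddVanish_range_final_of_isDirichletAvatar
    (hMW : MazurWiles1984.thm2_oddChiPart_classGroup_card_eq_pow_val_bernoulli) (hp2 : p ≠ 2)
    (hpL : ¬ p ∣ Module.finrank ℚ L) (ψ : (L ≃ₐ[ℚ] L) →* ℤ_[p]ˣ)
    {f : ℕ} [NeZero f] (χ : DirichletCharacter ℚ_[p] f) (m : ℕ) (hprim : χ.IsPrimitive)
    (havatar : IsDirichletAvatar L ψ χ m) (hodd : χ.Odd) (hB : ‖KrizLi2019.bernoulliOnePrim χ⁻¹‖ = 1)
    (r : absoluteGaloisGroup ℚ →* (ZMod p)ˣ)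
    (hr : ∀ τ : absoluteGaloisGroup ℚ,
      PadicInt.toZMod ((ψ (absGaloisQuot ℚ L τ) : ℤ_[p]ˣ) : ℤ_[p]) = ((r τ : (ZMod p)ˣ) : ZMod p))
    (G : absoluteGaloisGroup ℚ → ZMod p)
    (hGc : Continuous fun n : (absGaloisRestrict ℚ L).range => G n)
    (hadd : ∀ a ∈ (absGaloisRestrict ℚ L).range, ∀ b ∈ (absGaloisRestrict ℚ L).range, G (a * b) = G a + G b)
    (hconj : ∀ g, ∀ n ∈ (absGaloisRestrict ℚ L).range, G (g * n * g⁻¹) = (r g : ZMod p) * G n)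
    (hI : ∀ (ℓ : HeightOneSpectrum (𝓞 ℚ)) (𝔓 : Ideal (absIntegers (𝓞 ℚ) ℚ)), 𝔓 ∈ ℓ.primesAbove →
      ∀ n ∈ (absGaloisRestrict ℚ L).range, n ∈ 𝔓.inertia (absoluteGaloisGroup ℚ) → G n = 0) :
    ∀ n ∈ (absGaloisRestrict ℚ L).range, G n = 0 := by
  haveI : NeZero p := ⟨(Fact.out : p.Prime).ne_zero⟩
  exact oddVanishQ_of_forall_character_field r
    (fun κ hκ heq hunr =>
      absGaloisHom_eq_one_of_isDirichletAvatar hMW hp2 hpL ψ χ m hprim havatar hodd hB r hr κ hκ hunr heq)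
    G hGc hadd hconj hI

end Final

end Summit.BirchSwinnertonDyer.BirchSwinnertonDyer.Theorems.PrintCFram.HerbrandOddClassGroup

end
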